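import Mathlib
import Literature.MathematicalPhysics.StatisticalMechanics.Crystallization
import Literature.MathematicalPhysics.StatisticalMechanics.StickyChain

/-!
# Crux `ExactCertificate` (stmt-AtomisticToContinuum-11959), line `closure-makes-nogap-exact`,
# Transfer1D skeleton (`ExactCertificate1D`): stub `stub_posTypeOfPsi`

The doubling trick `F_a = -¼ Δ_a Ψ_a`.  With `V = lennardJones`, `b_k = (k+1)a` and
`S(c) = Σ_k (k+1) V(c + b_k)`, the tail interpolant of the `d = 1` exact certificate is
`F_a(x) = S(|x+a|) - 2 S(|x|) + S(|x-a|)` and `Ψ_a(y) = -4 S(|y|)`.  We prove: if `Ψ_a` is of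
positive type on `ℝ` (all finite Gram forms `Σ_{ij} w_i w_j Ψ_a(x_i - x_j)` are `≥ 0`), then
`F_a ∘ dist` is of positive type on `ℝ¹ = EuclideanSpace ℝ (Fin 1)`.

Proof: (0) for `a > 0`, `c ≥ 0` the series `Σ_k (k+1) V(c + b_k)` converges (comparison with
`Σ (k+1)^{-5}`), so the single `tsum` defining `F_a` splits into three; (1) on the line
`dist (y i) (y j) = |x_i - x_j|` and `{||δ|+a|, ||δ|-a|} = {|δ+a|, |δ-a|}`, so the `(i,j)` summand is
`-¼ w_i w_j [Ψ(δ+a) - 2Ψ(δ) + Ψ(δ-a)]`, `δ = x_i - x_j`; (2) applying the hypothesis to the `2n`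
points `(x, x + a)` with weights `(w, -w)` gives exactly `0 ≤ Σ w_i w_j [2Ψ(δ) - Ψ(δ+a) - Ψ(δ-a)]`.
-/

noncomputable section

namespace Summit.AtomisticToContinuum.Crystallization.Theorems.ThreeConeCertificateExactCertificate.Transfer1D

open Literature.MathematicalPhysics.StatisticalMechanics

/-- Comparison bound: for `a > 0`, `c ≥ 0`, `k ↦ (k+1)·(c + (k+1)a)^{-(p+3)}` is summable, being
dominated by `a^{-(p+3)} (k+1)^{-(p+2)}`. -/
private theorem summable_mul_inv_pow {a c : ℝ} (ha : 0 < a) (hc : 0 ≤ c) (p : ℕ) :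
    Summable (fun k : ℕ => ((k : ℝ) + 1) * (c + ((k : ℝ) + 1) * a)⁻¹ ^ (p + 3)) := by
  have hs : Summable (fun k : ℕ => ((k : ℝ) + 1)⁻¹ ^ (p + 2)) := by
    have h := Real.summable_nat_pow_inv.2 (by omega : 1 < p + 2)
    have h' := (summable_nat_add_iff 1).2 h
    refine h'.congr fun k => ?_
    push_cast
    rw [inv_pow]
  refine Summable.of_nonneg_of_le (fun k => ?_) (fun k => ?_) (hs.mul_left (a⁻¹ ^ (p + 3)))
  · have hX : 0 ≤ (c + ((k : ℝ) + 1) * a)⁻¹ := inv_nonneg.2 (add_nonneg hc (by positivity))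
    positivity
  · have hk : (0 : ℝ) < (k : ℝ) + 1 := by positivity
    have hX : 0 ≤ (c + ((k : ℝ) + 1) * a)⁻¹ := inv_nonneg.2 (add_nonneg hc (by positivity))
    have hle : (c + ((k : ℝ) + 1) * a)⁻¹ ≤ (((k : ℝ) + 1) * a)⁻¹ :=
      inv_anti₀ (by positivity) (le_add_of_nonneg_left hc)
    calc ((k : ℝ) + 1) * (c + ((k : ℝ) + 1) * a)⁻¹ ^ (p + 3)
        ≤ ((k : ℝ) + 1) * (((k : ℝ) + 1) * a)⁻¹ ^ (p + 3) :=
          mul_le_mul_of_nonneg_left (pow_le_pow_left₀ hX hle _) hk.le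
      _ = a⁻¹ ^ (p + 3) * ((k : ℝ) + 1)⁻¹ ^ (p + 2) := by
          rw [mul_inv, mul_pow, ← mul_assoc, pow_succ' ((k : ℝ) + 1)⁻¹ (p + 2), ← mul_assoc,
            mul_inv_cancel₀ hk.ne', one_mul, mul_comm]

/-- For `a > 0`, `c ≥ 0` the series `Σ_k (k+1)·V(c + (k+1)a)` (`V` = Lennard-Jones) converges. -/
private theorem summable_lj {a c : ℝ} (ha : 0 < a) (hc : 0 ≤ c) :
    Summable (fun k : ℕ => ((k : ℝ) + 1) * lennardJones (c + ((k : ℝ) + 1) * a)) := by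
  have h12 : Summable (fun k : ℕ => ((k : ℝ) + 1) * (c + ((k : ℝ) + 1) * a)⁻¹ ^ 12) :=
    summable_mul_inv_pow ha hc 9
  have h6 : Summable (fun k : ℕ => ((k : ℝ) + 1) * (c + ((k : ℝ) + 1) * a)⁻¹ ^ 6) :=
    summable_mul_inv_pow ha hc 3
  refine ((h12.mul_left (1 / 12)).sub (h6.mul_left (1 / 6))).congr fun k => ?_
  simp only [lennardJones]
  ring

/-- Splitting the single `tsum` of the second difference into three (all three series converge). -/
private theorem tsum_three {a p q r : ℝ} (ha : 0 < a) (hp : 0 ≤ p) (hq : 0 ≤ q) (hr : 0 ≤ r) :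
    ∑' k : ℕ, ((k : ℝ) + 1) * (lennardJones (p + ((k : ℝ) + 1) * a)
      - 2 * lennardJones (q + ((k : ℝ) + 1) * a) + lennardJones (r + ((k : ℝ) + 1) * a))
    = (∑' k : ℕ, ((k : ℝ) + 1) * lennardJones (p + ((k : ℝ) + 1) * a))
      - 2 * (∑' k : ℕ, ((k : ℝ) + 1) * lennardJones (q + ((k : ℝ) + 1) * a))
      + ∑' k : ℕ, ((k : ℝ) + 1) * lennardJones (r + ((k : ℝ) + 1) * a) := by
  have H := (((summable_lj ha hp).hasSum.sub ((summable_lj ha hq).hasSum.mul_left 2)).add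
    (summable_lj ha hr).hasSum)
  exact (H.congr_fun fun k => by ring).tsum_eq

/-- Split plus parity: with `S(c) = Σ_k (k+1)V(c + (k+1)a)` and `Ψ(y) = -4 S(|y|)`,
`Σ_k (k+1)[V(||δ|+a| + b_k) - 2V(||δ|| + b_k) + V(||δ|-a| + b_k)] = -¼[Ψ(δ+a) - 2Ψ(δ) + Ψ(δ-a)]`
(for `δ < 0` the two outer terms swap). -/
private theorem summand_eq {a : ℝ} (ha : 0 < a) (δ : ℝ) :
    ∑' k : ℕ, ((k : ℝ) + 1) * (lennardJones (|(|δ| + a)| + ((k : ℝ) + 1) * a)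
      - 2 * lennardJones (|(|δ|)| + ((k : ℝ) + 1) * a) + lennardJones (|(|δ| - a)| + ((k : ℝ) + 1) * a))
    = -(1 / 4) * ((-4 * ∑' k : ℕ, ((k : ℝ) + 1) * lennardJones (|δ + a| + ((k : ℝ) + 1) * a))
      - 2 * (-4 * ∑' k : ℕ, ((k : ℝ) + 1) * lennardJones (|δ| + ((k : ℝ) + 1) * a))
      + (-4 * ∑' k : ℕ, ((k : ℝ) + 1) * lennardJones (|δ - a| + ((k : ℝ) + 1) * a))) := by
  rw [tsum_three ha (abs_nonneg _) (abs_nonneg _) (abs_nonneg _), abs_abs]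
  rcases le_or_gt 0 δ with h | h
  · rw [abs_of_nonneg h]
    ring
  · rw [abs_of_neg h, show |-δ + a| = |δ - a| by rw [neg_add_eq_sub, abs_sub_comm],
      show |-δ - a| = |δ + a| by rw [← neg_add', abs_neg]]
    ring

/-- The doubling trick for an arbitrary kernel `Φ` of positive type on `ℝ`: evaluating the Gram
form at the `2n` points `(x, x + a)` with weights `(w, -w)` gives
`0 ≤ Σ_{ij} w_i w_j · (-¼)[Φ(δ+a) - 2Φ(δ) + Φ(δ-a)]`, `δ = x_i - x_j`. -/
private theorem doubling (Φ : ℝ → ℝ) (a : ℝ)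
    (hΦ : ∀ (n : ℕ) (x : Fin n → ℝ) (w : Fin n → ℝ), 0 ≤ ∑ i, ∑ j, w i * w j * Φ (x i - x j))
    (n : ℕ) (x : Fin n → ℝ) (w : Fin n → ℝ) :
    0 ≤ ∑ i, ∑ j, w i * w j * (-(1 / 4) * (Φ (x i - x j + a) - 2 * Φ (x i - x j) + Φ (x i - x j - a))) := by
  have h := hΦ (n + n) (Fin.append x fun i => x i + a) (Fin.append w fun i => -w i)
  simp only [Fin.sum_univ_add, Fin.append_left, Fin.append_right, add_sub_add_right_eq_sub] at h
  simp only [← sub_sub, add_sub_right_comm] at h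
  refine le_of_le_of_eq (mul_nonneg (by norm_num : (0 : ℝ) ≤ 1 / 4) h) ?_
  simp only [← Finset.sum_add_distrib, Finset.mul_sum]
  refine Finset.sum_congr rfl fun i _ => Finset.sum_congr rfl fun j _ => ?_
  ring

/-- **Stub `stub_posTypeOfPsi`** (doubling trick `F_a = -¼ Δ_a Ψ_a`): positive type of
`Ψ_a(y) = -4 Σ_k (k+1) V(|y| + (k+1)a)` on `ℝ` gives positive type of the tail interpolant
`F_a(x) = Σ_k (k+1)[V(|x+a| + (k+1)a) - 2V(|x| + (k+1)a) + V(|x-a| + (k+1)a)]`, as a function of the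
distance, on `ℝ¹ = EuclideanSpace ℝ (Fin 1)`. -/
theorem stub_posTypeOfPsi : ∀ a : ℝ, 0 < a →
    (∀ (n : ℕ) (x : Fin n → ℝ) (w : Fin n → ℝ),
      0 ≤ ∑ i, ∑ j, w i * w j * (-4 * ∑' k : ℕ, ((k : ℝ) + 1) * lennardJones (|x i - x j| + ((k : ℝ) + 1) * a))) →
    ∀ (n : ℕ) (y : Fin n → EuclideanSpace ℝ (Fin 1)) (w : Fin n → ℝ),
      0 ≤ ∑ i, ∑ j, w i * w j * ∑' k : ℕ, ((k : ℝ) + 1) * (lennardJones (|dist (y i) (y j) + a| + ((k : ℝ) + 1) * a)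
        - 2 * lennardJones (|dist (y i) (y j)| + ((k : ℝ) + 1) * a)
        + lennardJones (|dist (y i) (y j) - a| + ((k : ℝ) + 1) * a)) := by
  intro a ha hΨ n y w
  simp only [StickyChain.dist_eq_abs_sub, summand_eq ha]
  exact doubling (fun t => -4 * ∑' k : ℕ, ((k : ℝ) + 1) * lennardJones (|t| + ((k : ℝ) + 1) * a)) a hΨ
    n (fun i => y i 0) w

end Summit.AtomisticToContinuum.Crystallization.Theorems.ThreeConeCertificateExactCertificate.Transfer1D

end
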